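import Summits.NavierStokesRegularity.TurbBounds.CouplingSplit
import Summits.NavierStokesRegularity.TurbBounds.TailP2R4TableN12
import HarnessLib

/-!
# Row P2-R4 tail lemma (N12) — the exact coupling through profile mode `p = 3`: `couplingMode 12 8 3` written out with the
kernel-certified triple-product values (GENERATED by HOME/pub-turb-cert/lean-tail-v2/tailgen/emit/emit_tail.py N12 P2R4; kernel arithmetic only).

HONEST FRAMING: rigorous bounds for the stated PDE and boundary conditions; no claim about physical turbulence beyond the bound.
-/

set_option linter.style.longLine false
set_option linter.style.setOption false

noncomputable section

namespace Summit.NavierStokesRegularity.TurbBounds.TailP2R4.N12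

open Finset
open Summit.NavierStokesRegularity.TurbBounds.LadderTail (w)
open Summit.NavierStokesRegularity.TurbBounds.LegendreTriple (tripleCoeff)
open Summit.NavierStokesRegularity.TurbBounds.CouplingSplit (couplingMode)

set_option maxRecDepth 100000 in
set_option maxHeartbeats 20000000 in
/-- `couplingMode 12 8 3 b e` = the explicit `Λ`-weighted bilinear form over the index set `S` (profile mode `3`). -/
theorem couplingMode_3_eq (b e : ℕ → ℝ) :
    couplingMode 12 8 3 b e = (2/7 : ℝ) * (b 0 * e 3) + (6/35 : ℝ) * (b 1 * e 2) + (8/63 : ℝ) * (b 1 * e 4) + (6/35 : ℝ) * (b 2 * e 1) + (8/105 : ℝ) * (b 2 * e 3) + (20/231 : ℝ) * (b 2 * e 5) + (2/7 : ℝ) * (b 3 * e 0) + (8/105 : ℝ) * (b 3 * e 2) + (4/77 : ℝ) * (b 3 * e 4) + (200/3003 : ℝ) * (b 3 * e 6) + (8/63 : ℝ) * (b 4 * e 1) + (4/77 : ℝ) * (b 4 * e 3) + (40/1001 : ℝ) * (b 4 * e 5) + (70/1287 : ℝ) * (b 4 * e 7) + (20/231 : ℝ) * (b 5 * e 2) +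 (40/1001 : ℝ) * (b 5 * e 4) + (14/429 : ℝ) * (b 5 * e 6) + (112/2431 : ℝ) * (b 5 * e 8) + (200/3003 : ℝ) * (b 6 * e 3) + (14/429 : ℝ) * (b 6 * e 5) + (336/12155 : ℝ) * (b 6 * e 7) + (168/4199 : ℝ) * (b 6 * e 9) + (70/1287 : ℝ) * (b 7 * e 4) + (336/12155 : ℝ) * (b 7 * e 6) + (504/20995 : ℝ) * (b 7 * e 8) + (80/2261 : ℝ) * (b 7 * e 10) + (112/2431 : ℝ) * (b 8 * e 5) + (504/20995 : ℝ) * (b 8 * e 7) + (48/2261 : ℝ) * (b 8 * e 9) + (1650/52003 : ℝ) * (b 8 * e 11) + (168/4199 : ℝ) * (b 9 * e 6) + (48/2261 : ℝ) * (b 9 * e 8) + (990/52003 : ℝ) * (b 9 * e 10) + (88/3059 : ℝ) * (b 9 * e 12) + (80/2261 : ℝ) * (b 10 * e 7) + (990/52003 : ℝ) * (b 10 * e 9) + (264/15295 : ℝ) * (b 10 * e 11) + (572/21735 : ℝ) * (b 10 * e 13) + (1650/52003 : ℝ) * (b 11 * e 8) + (264/15295 : ℝ) * (b 11 * e 10)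 + (572/36225 : ℝ) * (b 11 * e 12) + (728/30015 : ℝ) * (b 11 * e 14) + (88/3059 : ℝ) * (b 12 * e 9) + (572/36225 : ℝ) * (b 12 * e 11) + (728/50025 : ℝ) * (b 12 * e 13) + (182/8091 : ℝ) * (b 12 * e 15) + (572/21735 : ℝ) * (b 13 * e 10) + (728/50025 : ℝ) * (b 13 * e 12) + (728/30015 : ℝ) * (b 14 * e 11) + (182/8091 : ℝ) * (b 15 * e 12) := by
  unfold couplingMode
  simp (maxSteps := 20000000) only [sum_range_succ, sum_range_zero, zero_add]
  norm_num only [tripleCoeff_eq_tab, tab, slices, slice0, slice1, slice2, slice3, slice4, slice5, slice6, slice7, slice8, List.getD_cons_zero, List.getD_cons_succ, List.getD_nil, w,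
    true_or, or_true, or_false, false_or, if_true, if_false]
  ring

end Summit.NavierStokesRegularity.TurbBounds.TailP2R4.N12

end
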